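import Summits.BirchSwinnertonDyer.BirchSwinnertonDyer.Theorems.KatoDescentTamePotSupersingularTameLowerVisibilityNn
import Summits.BirchSwinnertonDyer.Rank1Residual.X4.VisibilityRankOneFreePlaces
import Summits.BirchSwinnertonDyer.Rank1Residual.GaloisImage.PadicTwistClassDecider
import Literature.NumberTheory.GaloisRepresentations.LocalH2VanishingTrivialModule
import Literature.NumberTheory.GaloisRepresentations.TateLevelOneLocalGenerators
import HarnessLib

/-!
# Route `KatoDescentTamePotSupersingular` (rung K8-t′, cell `bsd-potss`), open core `TameLowerIntrinsicNonCM`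
# (item stmt-BirchSwinnertonDyer-19618) — L₀ at `5` for the Kurihara-lane RESIDUE row `302400ny1` by VISIBILITY from a
# RANK-ONE partner of the SAME level (`302400tz1`): NAMED-WITNESS road with a FREE place of kind (iii′) at `7`
# (a `--supports … --as helper` file; seat `bsd-potss-k8t-c2` g10; sibling of `…VisibilityOffSeed03.lean`)

PARTITION (D-0054): EXCLUDED-DOMAIN non-CM additive `p` · B4 (t′) (`e = 6`, Kodaira `II` at `p = 5`), `r_an = 0`, LOWER half L₀ —
instantiates-per-row (one theorem-backed certificate); closes NONE; shrinks-literal none; books nothing.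

THE ROW.  `W = 302400ny1 = [0,0,0,-17404595820,-887368723540560]`, `N = 302400 = 2⁶·3³·5²·7`, Kodaira `II` at `5`
(`v₅(c₄, c₆, Δ) = (1, 1, 2)`, `e = 6`), split `I₅` at `7`, `r_an = 0`, `#Ш_an = 25`, `∏ c_ℓ = 10`, `#W(ℚ)_tors = 1`, single-curve class,
`ρ̄_{W,5}` onto.  One of the rows of the open core's census that NO road had reached (kt-kur5 residue; k8t-c2 g8 §3 / g9 §8 named the
level-LOWERED rank-1 partners `43200t1`/`t2` — their generators are NOT `5`-divisible in `F(ℚ₅)` (they reduce to a smooth non-identity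
point of the type-`II` fibre), so the witness road is dead on them; kit j271923 of this seat, the level-free RANK-ONE screen, found the
SAME-LEVEL partner `302400tz1` as well).

THE ROAD.  `VisibleWitness.exists_sha_ne_zero_of_congr_of_locallyDivisible_or_relIndex_eq_one` (b2b-bsdres x10b gen 26): at each place
of `S = {2, 3, 5, 7}` EITHER the witness `P` has a `5`-th root locally OR the local conditions agree along `θ` (`ι_w(θ) = 1`).  Partner
`F = 302400tz1 = [0,0,0,36180,-19861200]` (rank `1`, generator `P = (790, 22400)`, `#F(ℚ)_tors = 1`, `∏ c_ℓ(F) = 40`):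
* `w = 2, 3`: `F` additive, `#F(ℚ_w)[5] = 1` (x10b's decider `fiveTorsionCheckAt`, empty certificates, precisions `5`, `2`) ⇒
  `ι_w(θ) = 1` (`relIndex_map_selmerLocalKer_eq_one_of_card_torsion_eq_one`) — kernel;
* `w = 7`: both curves SPLIT multiplicative `I₅` (`v₇(Δ) = 5` for both, `c₇(F) = 5`, so `F(ℚ₇)[5] ≅ ℤ/5` — `fiveTorsionCheckAt 7 … = some 2`
  — and `P` reduces to the node: neither option (a) nor (i) is available); the place is FREE of kind (iii′): `v₇(j(W)) = v₇(j(F)) = −5`,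
  `γ(W)/γ(F) = −296361589935/27524863183897` (`γ = −c₄/c₆`) is a `7`-adic unit and a square mod `7` (`sqFlagAt`), `μ₅(ℚ₇) = 1` ⇒
  `ι₇(θ) = 1` by `TwistedKummer.relIndex_map_selmerLocalKer_eq_one_of_one_lt_valuation_j` — kernel, CONDITIONAL on Tate's uniformisation
  `hU2` (A41, `Silverman1994_thmV53_corV54_tateUniformisation`, as in k8t-c2 g8's `…VisibilityOffSeed02.lean`);
* `w = 5` (= `p`): option (a), DISPLAYED as `h5div`: `P ∈ 5·F(ℚ₅)` — `F` has Kodaira `III` at `5` (`v₅(c₄, c₆, Δ) = (1, 2, 3)`), `c₅ = 2`,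
  `F(ℚ₅)[5] = 0` (`fiveTorsionCheckAt 5 … 1 [] = some 0`, and the filtration test `5·P₀ ∈ F₁ ∖ F₂`, seat folder census/), so
  `F(ℚ₅) ≅ ℤ₅ ⊕ ℤ/2` and `5F(ℚ₅) ⊇ F₁(ℚ₅) ∋ 2P` (`v₅(x(2P)) = −2`; `P` itself reduces to the cusp), whence `P ∈ 5F(ℚ₅)`; the tree's END
  `exists_nsmul_eq_baseChange_of_dvd_den` needs depth `2` at `ℓ = p`, and no representative of `P + 5F(ℚ)` has it — kernel discharge wants
  the degree-`25` division equation of `P` (kt-pdesc's `…VisibilityNnDivFive` pattern) — follow-up;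
* `P ∉ 5·F(ℚ)`: reduction certificate at the good prime `29` (`N₂₉ = 20`, `(20/5)·P = 4P` by two ladder doublings, `29 ∤ den x(4P)`) — kernel;
* `W[5]` irreducible (`ℓ = 13`, `#W̃(𝔽₁₃) = 19`, `a₁₃ = −5`, `X² + 3` rootless mod `5`), supports `|Δ_W| = 2⁶⁵3¹¹5²7⁵`, `|Δ_F| = 2²²3⁹5³7⁵`,
  minimality / `Δ ≠ 0` of `F`, `W(ℚ)` finite of order prime to `5` (GZK, `Irr`) — kernel.
BINDERS: `hCT`, `hGZK`, `hU2`; Cremona's `r_an = 0` and `#Ш_an = 25` (`hr0`, `hq`, `hv`); `θ : F[5] ⥲ W[5]` (evidence: kit j272314, engines A/B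
VERBATIM from kt-pdesc g2 j261046 / k8t-c2 g8 j262735 with `JOB_P = 5`: among ALL 1 064 Cremona curves of conductors `302400` and `43200` the
mod-`5` trace screen leaves exactly `{302400tz1, 43200t1, 43200t2}`; Kraus–Oesterlé 1992 Prop. 4 for `(W, 302400tz1)`: `M = 302400`, `S = ∅`,
`μ(M) = 829440`, all `12 861` primes `ℓ ≤ 138 239` PASS in engine A (PARI) = engine B (python, 85 s) identically; `W[5]` irreducible in the
kernel); `h5div`.
Then `Ш(W)[5] ≠ 0` and Cassels–Tate give `ord₅ #Ш(W) ≥ 2 = ord₅ #Ш_an(W)` = `MissingLowerBoundAt W 5`.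
HONEST LABEL: a per-class certificate modulo Cassels–Tate, GZK, Tate's uniformisation and the displayed data (`θ`, `h5div`); the stub
`stub_intr_kuriharaCerts_offSeed` / the item 19618 / the crux 19981 stay OPEN (class-wide = Kato Conj. 12.10 lower inclusion at an additive
potentially supersingular prime); nothing booked; BSD is not proved by any of this.  Effect on the census: the Kurihara-lane residue at
`p ≥ 5` loses `302400ny1` to a THEOREM-backed road.

References: [CremonaMazur2000] §3, Table 1; [AgasheStein2002] Lemma 3.6; [KrausOesterle1992] Prop. 4; [SilvermanATAEC1994] V.5.2(c), V.5.3, V.5.4;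
[SilvermanAEC2009] VII.2.1, VII.3.1, X.4.14; [Mazur1978] Prop. 6.3; [Kato2004Asterisque] Conj. 12.10; [Cremona2006] (labels 302400ny1, 302400tz1).
-/

set_option autoImplicit false
-- sibling precedent (`KatoDescentTamePotSupersingularTameLowerVisibilityNn.lean`): the directory name repeats the summit name
set_option linter.dupNamespace false

noncomputable section

open scoped Classical

open WeierstrassCurve Literature.NumberTheory.EllipticCurves
  Literature.NumberTheory.EllipticCurves.Rank1Residual
  Literature.NumberTheory.EllipticCurves.Rank1Residual.Typed
  Literature.NumberTheory.EllipticCurves.Rank1Residual.X11RankOneCertificates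
  Summit.BirchSwinnertonDyer.BirchSwinnertonDyer.Rank1Residual.IntModel
  Summit.BirchSwinnertonDyer.BirchSwinnertonDyer.Rank1Residual.X11RankOne
  Summit.BirchSwinnertonDyer.BirchSwinnertonDyer.Rank2Observatory
  Summit.BirchSwinnertonDyer.Rank1Residual.X11b
  Summit.BirchSwinnertonDyer.Rank1Residual.GaloisImage
  Summit.BirchSwinnertonDyer.Rank1Residual.Supersingular
  Summit.BirchSwinnertonDyer.Rank1Residual.Supersingular.LocalOddTorsion
open NumberField IsDedekindDomain Rat.HeightOneSpectrum

namespace Summit.BirchSwinnertonDyer.BirchSwinnertonDyer.Theorems.KTVis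

/-! ## `302400ny1 @ 5` ← the rank-`1` same-level partner `302400tz1`; kind (iii′) at `7`, witness `5`-divisible in `F(ℚ₅)` -/

/-- **The witness is not `5`-divisible in `F(ℚ)` (kernel).**  On `F = 302400tz1 = [0,0,0,36180,-19861200]` Cremona's generator
`P = (790, 22400)` satisfies `P ∉ 5·F(ℚ)`: at the good prime `29` (`Δ_F = −2²²·3⁹·5³·7⁵`) `N₂₉ = #F̃(𝔽₂₉) = 20`, and `(20/5)·P = 4P`
(two doublings of the `ℚ`-ladder, slopes supplied) is affine with `29 ∤ den x(4P)` (`not_mem_range_zsmul_of_reductionCert`).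
[cite: SilvermanAEC2009, Prop. VII.2.1] [cite: Cremona2006, Table 1 (label 302400tz1)] -/
theorem not_mem_range_zsmul_witness_c302400tz1 (F : WeierstrassCurve ℚ) [F.IsElliptic] [F.IsGloballyMinimal]
    (hFeq : F = ⟨0, 0, 0, 36180, -19861200⟩)
    (hT : F.toAffine.Nonsingular (790 : ℚ) (22400 : ℚ)) :
    (Affine.Point.some _ _ hT : F.toAffine.Point) ∉
      (zsmulAddGroupHom ((5 : ℕ) : ℤ) : F.toAffine.Point →+ F.toAffine.Point).range := by
  subst hFeq
  have hI : integralModelInt (⟨0, 0, 0, 36180, -19861200⟩ : WeierstrassCurve ℚ) = ⟨0, 0, 0, 36180, -19861200⟩ :=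
    integralModelInt_eq_of_map_eq _ (by ext <;> simp [WeierstrassCurve.map])
  haveI : Fact (Nat.Prime 29) := ⟨by norm_num⟩
  have hN : (⟨0, 0, 0, 36180, -19861200⟩ : WeierstrassCurve ℚ).reductionPointCount 29 = 20 :=
    reductionPointCount_eq_of_intModel_countPoints hI 29 (by norm_num) (by decide +kernel) (by decide +kernel)
  obtain ⟨hR, eR⟩ := nsmul_some_eq_of_ladderRunQ (W := (⟨0, 0, 0, 36180, -19861200⟩ : WeierstrassCurve ℚ))
    (xf := (6126899090521 : ℚ) / 1022080900) (yf := (-15172586090359852931 : ℚ) / 32675926373000) hT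
    [⟨false, (213 : ℚ) / 5, (5869 : ℚ) / 25, (156653 : ℚ) / 125, 0, 0, 0⟩,
      ⟨false, (2570367 : ℚ) / 31970, (6126899090521 : ℚ) / 1022080900, (-15172586090359852931 : ℚ) / 32675926373000, 0, 0, 0⟩] (by decide +kernel)
  rw [show qScalar 1 _ = 4 from by decide] at eR
  refine not_mem_range_zsmul_of_reductionCert _ 29 (not_dvd_minimalDiscriminantInt_of_intModel hI (by decide +kernel))
    (by rw [hN]; norm_num) _ hR ?_ (by decide +kernel)
  rw [hN]
  exact eR

/-- **The place `7` is FREE of kind (iii′) for the pair (`302400ny1`, `302400tz1`) at `p = 5`** (kernel numerals): `v₇(j(W)) = v₇(j(F)) = −5`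
(`7 ∣ den j`), `γ(W) = r²·γ(F)` in `ℚ₇` (`γ = −c₄/c₆`; the ratio `−296361589935/27524863183897` is a `7`-adic unit whose residue is a square:
`sqFlagAt 7 … 0`), and `μ₅(ℚ₇) = 1` (`5 ∤ 7`, `5 ∤ 7 − 1`).  Both curves are split `I₅` at `7`.
[cite: SilvermanATAEC1994, Ch. V Lemma 5.2 (c), Thm. 5.3, Cor. 5.4] [cite: CremonaMazur2000, §3] -/
theorem kindIIIPrime_v302400ny1_at7 (W W' : WeierstrassCurve ℚ) [W.IsElliptic] [W'.IsElliptic]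
    (hW : W = ⟨0, 0, 0, -17404595820, -887368723540560⟩) (hW' : W' = ⟨0, 0, 0, 36180, -19861200⟩)
    {v : HeightOneSpectrum (𝓞 ℚ)} (hv : (primesEquiv v : ℕ) = 7) :
    1 < v.valuation ℚ W.j ∧ 1 < v.valuation ℚ W'.j ∧
      (∃ r : v.adicCompletion ℚ, algebraMap ℚ (v.adicCompletion ℚ) (-(W.c₄ / W.c₆)) =
        r ^ 2 * algebraMap ℚ (v.adicCompletion ℚ) (-(W'.c₄ / W'.c₆))) ∧
      (∀ ζ : v.adicCompletion ℚ, ζ ^ 5 = 1 → ζ = 1) := by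
  haveI : Fact (Nat.Prime 7) := ⟨by norm_num⟩
  haveI : Fact (Nat.Prime 5) := ⟨by norm_num⟩
  have hj : W.j = -502229023208369508642555 / 2365374966787997696 := by
    rw [WeierstrassCurve.j_eq_c₄_pow_three_div_Δ]; subst hW
    norm_num [WeierstrassCurve.c₄, WeierstrassCurve.Δ, WeierstrassCurve.b₂, WeierstrassCurve.b₄,
      WeierstrassCurve.b₆, WeierstrassCurve.b₈]
  have hj' : W'.j = 8120601 / 268912 := by
    rw [WeierstrassCurve.j_eq_c₄_pow_three_div_Δ]; subst hW'
    norm_num [WeierstrassCurve.c₄, WeierstrassCurve.Δ, WeierstrassCurve.b₂, WeierstrassCurve.b₄,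
      WeierstrassCurve.b₆, WeierstrassCurve.b₈]
  have hA : -(W.c₄ / W.c₆) = -32230733 / 29578957451352 := by
    subst hW
    norm_num [WeierstrassCurve.c₄, WeierstrassCurve.c₆, WeierstrassCurve.b₂, WeierstrassCurve.b₄,
      WeierstrassCurve.b₆]
  have hB : -(W'.c₄ / W'.c₆) = 67 / 662040 := by
    subst hW'
    norm_num [WeierstrassCurve.c₄, WeierstrassCurve.c₆, WeierstrassCurve.b₂, WeierstrassCurve.b₄,
      WeierstrassCurve.b₆]
  refine ⟨TwistedKummer.one_lt_valuation_of_eq_of_dvd_den v hv hj (by norm_num) (by decide +kernel),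
    TwistedKummer.one_lt_valuation_of_eq_of_dvd_den v hv hj' (by norm_num) (by decide +kernel), ?_, ?_⟩
  · rw [hA, hB]
    exact LocalTorsion3At.exists_eq_sq_mul_of_sqFlagAt v hv (by norm_num) (D := 27524863183897)
      (by norm_num) (N := -296361589935) (by norm_num) (w := 0) (by norm_num) (by decide +kernel)
      (by decide +kernel)
  · have hcard : Literature.NumberTheory.GaloisRepresentations.IsNonarchimedeanLocalField.residueFieldCard
        (v.adicCompletion ℚ) = 7 :=
      Literature.NumberTheory.GaloisRepresentations.residueFieldCard_adicCompletion_rat 7 v hv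
    exact Literature.NumberTheory.GaloisRepresentations.forall_pow_eq_one_imp_eq_one_of_not_dvd
      (F := v.adicCompletion ℚ) (p := 5) (by rw [hcard]; norm_num) (by rw [hcard]; norm_num)

/-- **L₀ at `5` for `302400ny1` by VISIBILITY, WITNESS ROAD with the FREE place `7` of kind (iii′)** (`N = 302400 = 2⁶·3³·5²·7`, (t′)
at `5`: Kodaira `II`, `e = 6`; `ρ̄_{W,5}` onto; `r_an = 0`, `#Ш_an = 25`, torsion `1`; single-curve class): `MissingLowerBoundAt W 5` from
Cassels–Tate (`hCT`), GZK (`hGZK`), Tate's uniformisation (`hU2`), Cremona's `r_an = 0` / `#Ш_an` (`hr0`, `hq`, `hv`), a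
`Γ_ℚ`-isomorphism `θ : F[5] ⥲ W[5]` from the RANK-1 partner `F = 302400tz1` of the same conductor (Kraus–Oesterlé Prop. 4 mod `5`: `M = 302400`, `S = ∅`, all
`ℓ ≤ 138 239`, two engines, kit j272314) and ONE local datum `h5div`: the generator `P = (790, 22400)` of `F(ℚ)` has a fifth root in `F(ℚ₅)` (`III`, `c₅ = 2`,
`F(ℚ₅)[5] = 0`, `2P ∈ F₁(ℚ₅)`).  The transported Kummer class of `P` is Selmer for `W`: at `2, 3` because `#F(ℚ_w)[5] = 1` (decider ⇒
`ι_w(θ) = 1`), at `7` because the place is free of kind (iii′) (`kindIIIPrime_v302400ny1_at7` ⇒ `ι₇(θ) = 1`, conditional on `hU2`), at `5`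
by `h5div`, elsewhere by good reduction (supports `2⁶⁵3¹¹5²7⁵ / 2²²3⁹5³7⁵`); it is non-zero because `P ∉ 5F(ℚ)` (kernel:
`not_mem_range_zsmul_witness_c302400tz1`).  KERNEL also: `W[5]` irreducible (`ℓ = 13`, `#W̃(𝔽₁₃) = 19`, `X² + 3` rootless mod `5`),
minimality and `Δ ≠ 0` of `F`.  Then `Ш(W)[5] ≠ 0` and Cassels–Tate give `ord₅ #Ш ≥ 2 = ord₅ #Ш_an`.  Per class; stub / item NOT closed;
nothing booked.  [cite: CremonaMazur2000, §3 and Table 1] [cite: AgasheStein2002, Lemma 3.6] [cite: KrausOesterle1992, Prop. 4]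
[cite: SilvermanATAEC1994, Ch. V Thm. 5.3, Cor. 5.4] [cite: Mazur1978, Prop. 6.3 (1)] [cite: SilvermanAEC2009, VII.2.1, VII.5 Prop. 5.1(a), Thm. X.4.14]
[cite: Cremona2006, Table 1 (labels 302400ny1, 302400tz1)] -/
theorem missingLower5_vis_302400ny1 (hCT : exists_casselsTate_pairing (K := ℚ))
    (hGZK : rank_eq_analyticRank_of_analyticRank_le_one)
    (hU2 : Silverman1994_thmV53_corV54_tateUniformisation.{0})
    (W : WeierstrassCurve ℚ) [W.IsElliptic] [W.IsGloballyMinimal] (hWeq : W = ⟨0, 0, 0, -17404595820, -887368723540560⟩)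
    (hr0 : W.analyticRank = 0) {q : ℚ} (hq : shaAn W = (q : ℂ)) (hv : padicValRat 5 q ≤ 2)
    (F : WeierstrassCurve ℚ) (hFeq : F = ⟨0, 0, 0, 36180, -19861200⟩)
    (θ : geomTorsion F (5 : ℤ) ≃+ geomTorsion W (5 : ℤ))
    (hθ : ∀ (σ : Field.absoluteGaloisGroup ℚ) (P : geomTorsion F (5 : ℤ)), θ (σ • P) = σ • θ P)
    (h5div : ∀ w : HeightOneSpectrum (𝓞 ℚ), (primesEquiv w : ℕ) = 5 →
      ∀ hT : F.toAffine.Nonsingular (790 : ℚ) (22400 : ℚ),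
        ∃ Q : (F.baseChange (w.adicCompletion ℚ)).toAffine.Point,
          5 • Q = WeierstrassCurve.Affine.Point.baseChange (W' := F) ℚ (w.adicCompletion ℚ) (.some _ _ hT)) :
    MissingLowerBoundAt W 5 := by
  haveI hFell : F.IsElliptic := by
    rw [hFeq]
    exact Summit.BirchSwinnertonDyer.Rank1Residual.X11b.isElliptic_of_discOf_ne_zero 0 0 0 36180 (-19861200)
      (by decide +kernel)
  haveI hFmin : F.IsGloballyMinimal := by
    rw [hFeq]
    exact isGloballyMinimal_of_krausCriterion_bounded 0 0 0 36180 (-19861200)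
      (by decide +kernel) (by decide +kernel) (by decide +kernel)
  have hIW : integralModelInt W = ⟨0, 0, 0, -17404595820, -887368723540560⟩ :=
    integralModelInt_eq_of_map_eq _ (by rw [hWeq]; exact map_mk_int 0 0 0 (-17404595820) (-887368723540560))
  -- `W[5]` irreducible: Frobenius witness at `ℓ = 13` (`#W̃(𝔽₁₃) = 19`, `a₁₃ = -5`, `X² + 3` has no root mod `5`)
  have hirr : Irr W 5 := by
    haveI : Fact (Nat.Prime 13) := ⟨by norm_num⟩
    exact hasIrreducibleModPGaloisRep_of_intModel_of_noroot hIW 5 13 (by norm_num) (by decide +kernel)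
      (natCard_point_eq_of_countPoints 0 0 0 (-17404595820) (-887368723540560) 13 (by norm_num)
        (by decide +kernel) (n := 19) (by decide +kernel)) (by decide)
  haveI hfin : Finite W.toAffine.Point := finite_point_of_analyticRank_eq_zero W hGZK hr0
  have hcop : (Nat.card W.toAffine.Point).Coprime 5 := coprime_natCard_point_of_irr W 5 hirr
  have hT : F.toAffine.Nonsingular (790 : ℚ) (22400 : ℚ) :=
    (WeierstrassCurve.Affine.equation_iff_nonsingular (W := F.toAffine)).mp
      (by rw [hFeq]; exact (WeierstrassCurve.Affine.equation_iff _ _).mpr (by norm_num))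
  have hTP := not_mem_range_zsmul_witness_c302400tz1 F hFeq hT
  -- kind (i) at `2, 3`: `#F(ℚ_w)[5] = 1` by x10b's decider (empty certificates)
  have h2 : ∀ w : HeightOneSpectrum (𝓞 ℚ), (primesEquiv w : ℕ) = 2 →
      Nat.card (nsmulAddMonoidHom 5 : (F.baseChange (w.adicCompletion ℚ)).toAffine.Point →+ _).ker = 1 :=
    fun w hw ↦
      natCard_ker_nsmul_five_adicCompletion_eq_one_of_checkAt 2 0 0 0 36180 (-19861200) (by decide +kernel)
        (k := 5) (cert := []) (by decide +kernel) F hFeq hw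
  have h3 : ∀ w : HeightOneSpectrum (𝓞 ℚ), (primesEquiv w : ℕ) = 3 →
      Nat.card (nsmulAddMonoidHom 5 : (F.baseChange (w.adicCompletion ℚ)).toAffine.Point →+ _).ker = 1 :=
    fun w hw ↦
      natCard_ker_nsmul_five_adicCompletion_eq_one_of_checkAt 3 0 0 0 36180 (-19861200) (by decide +kernel)
        (k := 2) (cert := []) (by decide +kernel) F hFeq hw
  set L : List ℕ := [2, 3, 5, 7] with hL
  have hLp : ∀ r ∈ L, r.Prime := by decide
  have hΔE : ∀ r : ℕ, r.Prime → (r : ℤ) ∣ (⟨0, 0, 0, -17404595820, -887368723540560⟩ : WeierstrassCurve ℤ).Δ → r ∈ L :=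
    forall_mem_of_natAbs_eq_prod_pow L [65, 11, 2, 5] hLp (by decide +kernel)
  have hΔF : ∀ r : ℕ, r.Prime → (r : ℤ) ∣ (⟨0, 0, 0, 36180, -19861200⟩ : WeierstrassCurve ℤ).Δ → r ∈ L :=
    forall_mem_of_natAbs_eq_prod_pow L [22, 9, 3, 5] hLp (by decide +kernel)
  set e := primesEquiv (R := 𝓞 ℚ) with he
  set S : Finset (HeightOneSpectrum (𝓞 ℚ)) :=
    (L.filterMap fun r ↦ if h : r.Prime then some (e.symm ⟨r, h⟩) else none).toFinset with hSdef
  have hmemS : ∀ w : HeightOneSpectrum (𝓞 ℚ), w ∈ S ↔ (e w : ℕ) ∈ L := by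
    intro w
    rw [hSdef, List.mem_toFinset, List.mem_filterMap]
    constructor
    · rintro ⟨r, hr, hrw⟩
      by_cases hrp : r.Prime
      · rw [dif_pos hrp, Option.some.injEq] at hrw
        rw [← hrw, Equiv.apply_symm_apply]; exact hr
      · rw [dif_neg hrp] at hrw; exact absurd hrw (by simp)
    · intro hw
      refine ⟨(e w : ℕ), hw, ?_⟩
      rw [dif_pos (e w).2]; simp
  have hS : ∀ w : HeightOneSpectrum (𝓞 ℚ), w ∉ S →
      W.HasGoodReductionAt w ∧ F.HasGoodReductionAt w ∧ ((5 : ℕ) : 𝓞 ℚ) ∉ w.asIdeal := by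
    intro w hwS
    have hwL : (e w : ℕ) ∉ L := fun h ↦ hwS ((hmemS w).mpr h)
    have hqp : (e w : ℕ).Prime := (e w).2
    refine ⟨?_, ?_, natCast_not_mem_of_primesEquiv_ne w Fact.out fun h ↦ hwL ?_⟩
    · rw [hWeq]; exact hasGoodReductionAt_mk_of_primesEquiv _ _ _ _ _ w rfl fun h ↦ hwL (hΔE _ hqp h)
    · rw [hFeq]; exact hasGoodReductionAt_mk_of_primesEquiv _ _ _ _ _ w rfl fun h ↦ hwL (hΔF _ hqp h)
    · show (primesEquiv w : ℕ) ∈ L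
      rw [h]; decide
  have hdiv : ∀ w ∈ S,
      (∃ Q : (F.baseChange (w.adicCompletion ℚ)).toAffine.Point,
        5 • Q = WeierstrassCurve.Affine.Point.baseChange (W' := F) ℚ (w.adicCompletion ℚ) (.some _ _ hT)) ∨
      (selmerLocalKer W (w.adicCompletion ℚ) ((5 : ℕ) : ℤ)).relIndex
        ((selmerLocalKer F (w.adicCompletion ℚ) ((5 : ℕ) : ℤ)).map (h1Equiv θ hθ).toAddMonoidHom) = 1 := by
    intro w hwS
    have hwL : (e w : ℕ) ∈ L := (hmemS w).mp hwS
    have hcases : (e w : ℕ) = 2 ∨ (e w : ℕ) = 3 ∨ (e w : ℕ) = 5 ∨ (e w : ℕ) = 7 := by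
      simp only [hL, List.mem_cons, List.mem_nil_iff, or_false] at hwL
      omega
    rcases hcases with hw | hw | hw | hw
    · exact Or.inr (relIndex_map_selmerLocalKer_eq_one_of_card_torsion_eq_one W F θ hθ
        (natCast_not_mem_of_primesEquiv_ne w Fact.out (by rw [hw]; decide)) (h2 w hw))
    · exact Or.inr (relIndex_map_selmerLocalKer_eq_one_of_card_torsion_eq_one W F θ hθ
        (natCast_not_mem_of_primesEquiv_ne w Fact.out (by rw [hw]; decide)) (h3 w hw))
    · exact Or.inl (h5div w hw hT)
    · obtain ⟨hjW, hjF, hγ, hμ⟩ := kindIIIPrime_v302400ny1_at7 W F hWeq hFeq hw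
      exact Or.inr (TwistedKummer.relIndex_map_selmerLocalKer_eq_one_of_one_lt_valuation_j W w hU2 (by norm_num)
        F θ hθ hjW hjF hγ hμ)
  obtain ⟨c, hc0, hc5⟩ :=
    VisibleWitness.exists_sha_ne_zero_of_congr_of_locallyDivisible_or_relIndex_eq_one W F (by norm_num) θ hθ S hS
      hfin hcop (.some _ _ hT) (by convert hTP) hdiv
  have hfinSha : W.ShaFinite := (hGZK W (by rw [hr0]; norm_num)).2
  exact missingLowerBoundAt_of_casselsTate_of_pow_dvd W 5 hCT hfinSha hq (k := 1) (by simpa using hv)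
    (by simpa using dvd_shaOrder_of_exists_torsion W 5 ⟨c, hc0, hc5⟩)

end Summit.BirchSwinnertonDyer.BirchSwinnertonDyer.Theorems.KTVis

end
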